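import Summits.QuantumFields.BalabanUV.Beta.D1BFx.DiagBracketWordMass
import Summits.QuantumFields.BalabanUV.Beta.SymCorrectorFaceWeightSplit
import Summits.QuantumFields.BalabanUV.Beta.D1BFx.PackedColumnEnvelopeSplit
import Summits.QuantumFields.BalabanUV.Beta.D1BFx.FaceWeightMasses
import Summits.QuantumFields.BalabanUV.Beta.D1BFx.StraightPinVertexFamilies
import Summits.QuantumFields.BalabanUV.Beta.ChartConjugationReflection
import Summits.QuantumFields.BalabanUV.Beta.AxialDressingRootedBmHessian

/-!
# `BalabanUV.Beta.D1BFx.ChartDefectRowLamfMass` — road «BF-x», binder row D1, PART 24-hyb HEAD (`ChartDefectHead` v1.1's rows), **THE FACE Λ-SECTOR ROW (lamf) IN MASS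
# CURRENCY** (leaf-03 g34, TT31; the (lamf) sibling of TT27b `ChartDefectRowMcolMass` ∕ TT28 `ChartDefectRowMsMass`): the HEAD's (lamf) word — LITERALLY
# `z ↦ ½·tadpole G₀ (W^{Λ}_f a 0 e z)`, `W^{Λ}_f = ([Λf e z, V♭ a 0] + [Λf a 0, V♭ e z]) − ([Λf e z, V⁰ a 0] + [Λf a 0, V⁰ e z])` with the FACE Λ-generator
# `Λf μ y = diagK (x b ↦ −Σ_α Σ_{x′ ∈ block(legSite ρ_c x b)} colH G₀ n μ y α x′·((n⁴∕2)·faceWt (ctrOff 4 n) n α x′))` and the two first-jet vertex families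
# `V♭ = vertexOfK G₀ n S♭`, `V⁰ = vertexOfK G₀ n S⁰` (`S♭ = n⁴•wilsonA + (−n⁸∕2)•symVhSAt ρ_c`, `S⁰ = (JsB12CombSh0 … 0).S`) — IS `−cΛ∕2 ·` THE BRACKET WORD OF `Λf` AGAINST THE
# Λ-SECTOR FAMILY `V_Λ = vertexOfK G₀ n S_Λ` ALONE (`S⁰ = S♭ + cΛ•S_Λ`, `S_Λ = SLam n (lamCoeffOf (KInv n) n) (symHessFFAt ρ_c n)` — `CombFormSlotGaugeLetter.JsB12CombSh0_S_zero`), and is a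
# (5.10)-kernel in the coarse variable with a CLOSED, `n`-FREE-rate constant modulo the DISPLAYED leg letter `Bdd G₀ S` and ONE vertex-mass letter `hV` (the σ-weighted `ℓ¹` mass of `V_Λ`):
# `Decay510 (…) ((|cΛ|∕2)·(S·(2·GΛ(n)·MV + 2·GΛ(n)·MV))) (n·σ)`.

THE SHEET QUESTION OF ROW (lamf) (leaf-03 g33 N-1 PS; the OWNER d1-p2 g25 W-g25-8 (a)∕(c)).  The face weight at scalar `n⁴∕2` through ONE envelope of the bm-dressed column reads `≍ n`
(the face-sheet power `(n⁴)⁻¹` against the block mass `faceWtSum ≍ 16n`).  Here the block is SPLIT into its face layer `P x := ∃ i, off n x i = 0 ∨ off n x i = n − 1` and the interior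
(TT29 `SymCorrectorFaceWeightSplit.abs_blockSymbol_le_mass_split`): off the faces the column is `Ci = (n⁵)⁻¹·(8·C₄′·e^{κ′})` (gan24-leaf-05 g63 «G0-COL-ENV-INTERIOR»
`PackedColumnEnvelopeSplit.abs_colH_G₀_pin_interior_le`) against the interior weight mass `Bi = (n⁴∕2)·(4·(n·4)) = 8n⁵` (TT30 `FaceWeightMasses.interiorMass_smul_faceWt_le`); on them it is
`Cf = (n⁴)⁻¹·C_G′` (`abs_colH_G₀_pin_face_le`) against the face-layer mass `Bf = (n⁴∕2)·(|box|⁻¹·(2·16·n⁴)) = 16n⁴` (TT30 `faceMass_smul_faceWt_le`, `3 ≤ n`): `Ci·Bi + Cf·Bf = 64·C₄′·e^{κ′} + 16·C_G′`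
— `GΛ(n) = (Ci·Bi + Cf·Bf)·e^{r_G(|ρ_c|₁ + 4n)} = O(1)` (`|ρ_c|₁ ≤ 4n`, §1 `exp_rG_le`).  LOCATED COUNT (zero weight): NET `C_lamf ≍ |cΛ|·S·MV_Λ`, rate `n`-free.

HOW.  §1 the generator envelopes (split `GΛ`, one-envelope `GΛ₁`, scale-free pieces); §2 the bracket word for ANY family `V` of σ-weighted mass `≤ MV` (TT27a `decay510_bracketWord_of_wmass`);
§3 `V⁰ = V♭ + cΛ•V_Λ` (`JsB12CombSh0_S_zero`, an2 `vertexOfK_add`, g62's LocStencil records), the word `= (−cΛ)•` the `V_Λ`-bracket (`comp_diagK_left ∕ _right`), the tadpole pulls the scalar;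
§4 the HEAD's literal (`decay510_row_lamf_mass_of_env ∕ _of_wmass`, `row_lamf_mass_of_wmass` = `hAlamf ∕ hBlamf`).  Vertex side + records: `ChartDefectRowLamfClosed`; scales: `ChartDefectRowLamfScales`.

HONEST DEPENDENCY (cell records, verbatim): «continuum YM on T⁴ ⇐ BetaPertH ∧ nine spine estimates (0/9 proved); BetaPertH ⇐ (D1) ∧ (D4) ∧
CAP+tail; G-an2-4 gates asym, D1 and NE2/3/4.»  HONEST FRAMING (cell contract, verbatim): «discharging `BetaPertH` makes Bałaban's UV stability
UNCONDITIONAL — a real constructive-QFT result; it is NOT the continuum limit and NOT the Clay problem.»  THIS MODULE is [folklore] `ℓ¹` ∕ (1.22) read-out bookkeeping BY NAME over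
landed objects; ONE displayed row of the HEAD priced MODULO two displayed letters (`Bdd G₀ S`, the Λ-pack's vertex mass `MV`) — per-word INTERMEDIATE (an2 R-D1-g45-4 (3)), not the HEAD,
not the END; no definition, no `def … : Prop`, nothing cited, 0 sorry.  0∕4 row-D1 binders (hW ∕ hR ∕ D1Tel ∕ D1Rep); (J1) ONE OPEN ROW (eight displayed rows); (K) NOT closed; NOT D1,
NEVER «G-an2-4 closed», NOT `BetaPertH`, NOT continuum, NOT Clay.

ABSOLUTE RULE (cell charter, verbatim): «No internally-minted statement may enter as a cited fact. Every hypothesis is either kernel-proved in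
this package or a verbatim quotation of a PUBLISHED theorem with page reference. The manuscript(s) under audit are NOT citable for their own
disputed steps — they are the thing under adjudication; programme-internal (2001/route/tribunal) claims are never citable.»

Unit `b2b-balaban-beta-d1-formalise-leaf-03` (gen 34), D1 formalisation swarm LEAF PROVER 03, road «BF-x»; 2026-08-24.  No existing file touched.
-/

noncomputable section

namespace Summit.QuantumFields.BalabanUV.Beta.D1BFx.ChartDefectRowLamfMass

open Finset
open scoped BigOperators
open Literature.MathematicalPhysics.QuantumFieldTheory
open Literature.MathematicalPhysics.QuantumFieldTheory.Balaban1983to89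
open Literature.MathematicalPhysics.QuantumFieldTheory.Balaban1983to89.Beta
open B12Sec2to5 (l1 l1_nonneg Decay510 secondMoment_abs_le_of_decay510)
open DecimatedMomentSummable (AbsMoment₂ absMoment₂_of_decay510)
open B5Hk163Strip (kappa163 kappa163_pos)
open B5Hk163Decay (MG163)
open B5Hk163TorusHolderDecay (MD163)
open B4TorusKernel (periodConst)
open ExpKernelCalculus (Site MKer Decays BiLoc comp tadpole)
open AffineAveraging (box toSite)
open AveragingContours (blk off)
open AveragingContoursRooted (ctr ctrOff ctrOff_mem_box)
open KernelWard (Bdd)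
open KernelReflection (tadpole_smul)
open OneStepResolventKernel (Fib KInv LocStencil)
open OneStepKernelFamily (colH KInvStep vertexOfK)
open InterLevelTransport (SLam)
open StepJetData (wilsonA)
open BalabanStepJets (lamCoeffOf)
open Summit.QuantumFields.BalabanUV.Beta.BorderedHessian (diagK comp_diagK_left comp_diagK_right)
open Summit.QuantumFields.BalabanUV.Beta.AxialDressingRooted (coDressKBmAt decays_coDressKBmAt_KInvStep)
open Summit.QuantumFields.BalabanUV.Beta.AveragingWardRootedStencils (legSite)
open Summit.QuantumFields.BalabanUV.Beta.CompositeCorrectorLocality (blockSitesF)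
open Summit.QuantumFields.BalabanUV.Beta.SymAveragingHessianCounts (symVhSAt symHessFFAt)
open Summit.QuantumFields.BalabanUV.Beta.SymSecondOrderTablesAn1 (symTablesAn1S2)
open Summit.QuantumFields.BalabanUV.Beta.CombChartStepJets (JsB12CombSh0)
open Summit.QuantumFields.BalabanUV.Beta.CombFormSlotGaugeLetter (JsB12CombSh0_S_zero)
open Summit.QuantumFields.BalabanUV.Beta.ChartConjugationReflection (vertexOfK_add)
open Summit.QuantumFields.BalabanUV.Beta.SymCorrectorFace (faceWt)
open Summit.QuantumFields.BalabanUV.Beta.SymCorrectorFaceWeightSplit (abs_blockSymbol_le_mass_split)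
open Summit.QuantumFields.BalabanUV.Beta.D1BFx.PackedColumnBlockTotalMass (l1_toSite_le_of_mem_box)
open Summit.QuantumFields.BalabanUV.Beta.D1BFx.PackedColumnEnvelopeSplit (abs_colH_G₀_pin_interior_le abs_colH_G₀_pin_face_le abs_colH_G₀_pin_le
  pin_interior_weight_nonneg pin_face_weight_nonneg pin_rate_nonneg)
open Summit.QuantumFields.BalabanUV.Beta.SymCorrectorFaceWeight (blockMass_smul_faceWt_eq abs_blockSymbol_le_mass_of_col)
open Summit.QuantumFields.BalabanUV.Beta.D1BFx.FaceWeightMasses (faceWtSum_ctrOff_le interiorMass_smul_faceWt_le faceMass_smul_faceWt_le)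
open Summit.QuantumFields.BalabanUV.Beta.D1BFx.StraightPinVertexFamilies (locStencil_Sflat_record locStencil_SLam_record)
open Summit.QuantumFields.BalabanUV.Beta.D1BFx.DiagBracketWordMass (decay510_bracketWord_of_wmass)

variable {d : ℕ}

section Record

variable (n : ℕ) [NeZero n]

/-! ## §1 The face Λ-generator's symbol through the leg, split into interior and face -/

omit [NeZero n] in
/-- [folklore] The centred root is in the block: `|ρ_c|₁ ≤ 4n` (g62 `l1_toSite_le_of_mem_box` at lit `ctrOff_mem_box`; `ctr 4 n = toSite (ctrOff 4 n)`). -/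
theorem l1_ctr_le (hn : 1 ≤ n) : l1 (ctr 4 n) ≤ (((3 + 1 : ℕ) : ℕ) : ℝ) * (n : ℝ) :=
  l1_toSite_le_of_mem_box (ctrOff_mem_box (d := 3 + 1) hn)

omit [NeZero n] in
/-- [folklore] The leg-and-block exponential at the rate `r_G = κ′∕(4n)` is SCALE-FREE: `e^{r_G(|ρ_c|₁ + 4n)} ≤ e^{2κ′}`. -/
theorem exp_rG_le (hn : 1 ≤ n) :
    Real.exp ((kappa163 4 / 4 / (4 * ((n : ℕ) : ℝ))) * (l1 (ctr 4 n) + ((3 + 1 : ℕ) : ℝ) * (n : ℝ))) ≤ Real.exp (2 * (kappa163 4 / 4)) := by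
  have hκ : 0 < kappa163 4 := kappa163_pos 4
  have hn0 : (0 : ℝ) < n := by exact_mod_cast hn
  have hl := l1_ctr_le n hn
  refine Real.exp_le_exp.2 ?_
  have h8 : l1 (ctr 4 n) + ((3 + 1 : ℕ) : ℝ) * (n : ℝ) ≤ 8 * (n : ℝ) := by push_cast at hl ⊢; linarith
  calc (kappa163 4 / 4 / (4 * ((n : ℕ) : ℝ))) * (l1 (ctr 4 n) + ((3 + 1 : ℕ) : ℝ) * (n : ℝ))
      ≤ (kappa163 4 / 4 / (4 * ((n : ℕ) : ℝ))) * (8 * (n : ℝ)) := mul_le_mul_of_nonneg_left h8 (by positivity)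
    _ = 2 * (kappa163 4 / 4) := by field_simp; ring

omit [NeZero n] in
/-- [folklore] `0 ≤ C_int′ := 8·C₄′·e^{κ′}` (g63's interior weight at the blocking `1`). -/
theorem cInt_nonneg : 0 ≤ (8 * (MD163 4 * periodConst (kappa163 4) 3) * Real.exp (kappa163 4 / 4)) := by
  have h := pin_interior_weight_nonneg 1
  simp only [Nat.cast_one, one_pow, inv_one, one_mul] at h
  exact h

omit [NeZero n] in
/-- [folklore] `0 ≤ C_G′ := C₄·(1 + 8(1 + e^{κ′}))·e^{κ′}` (g63's face weight at the blocking `1`). -/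
theorem cG_nonneg : 0 ≤ ((MG163 4 * periodConst (kappa163 4) 3) * (1 + 8 * (1 + Real.exp (kappa163 4 / 4))) * Real.exp (kappa163 4 / 4)) := by
  have h := pin_face_weight_nonneg 1
  simp only [Nat.cast_one, one_pow, inv_one, one_mul] at h
  exact h

/-- [folklore] **THE FACE Λ-GENERATOR `Λf[G₀]`'s SYMBOL THROUGH THE LEG, INTERIOR ∕ FACE SPLIT** (`3 ≤ n`; sign included): at every leg site,
`|−Σ_α Σ_{x′ ∈ blockSitesF n (blk n (legSite ρ_c x b))} colH G₀ n μ y α x′·((n⁴∕2)·faceWt (ctrOff 4 n) n α x′)| ≤ GΛ(n)·e^{−r_G|x − n•y|₁}`,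
`GΛ(n) = (Ci·Bi + Cf·Bf)·e^{r_G(|ρ_c|₁ + 4n)}`, `r_G = κ′∕(4n)` — TT29 `abs_blockSymbol_le_mass_split` at the face-layer predicate `P x := ∃ i, off n x i = 0 ∨ off n x i = n − 1` with
`hint ∕ hface :=` g63 `abs_colH_G₀_pin_interior_le ∕ abs_colH_G₀_pin_face_le`, `hci ∕ hcf :=` TT30 `interiorMass_smul_faceWt_le ∕ faceMass_smul_faceWt_le` (`ξ := n⁴∕2`, `|ξ| = ξ`).
Located: `Ci·Bi + Cf·Bf = 64·C₄′·e^{κ′} + 16·C_G′ = O(1)` (v. `≍ n` through one envelope). -/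
theorem abs_faceLamGen_G₀_legSite_le (hn3 : 3 ≤ n) (μ : Fin (3 + 1)) (y x : Site 4) (b : Fib 3) :
    |-(∑ α : Fin (3 + 1), ∑ x' ∈ blockSitesF n (blk n (legSite (ctr 4 n) x b)), colH (coDressKBmAt (ctr 4 n) n (KInvStep (d := 3) n 0)) n μ y α x' * (((n : ℝ) ^ 4 / 2) * faceWt (ctrOff 4 n) n α x'))|
      ≤ ((((((n : ℕ) : ℝ) ^ 5)⁻¹ * (8 * (MD163 4 * periodConst (kappa163 4) 3) * Real.exp (kappa163 4 / 4))) * ((n : ℝ) ^ 4 / 2 * ((((3 : ℕ) : ℝ) + 1) * ((n : ℝ) * (((3 : ℕ) : ℝ) + 1)))) + ((((n : ℕ) : ℝ) ^ 4)⁻¹ * ((MG163 4 * periodConst (kappa163 4) 3) * (1 + 8 * (1 + Real.exp (kappa163 4 / 4))) * Real.exp (kappa163 4 / 4))) * ((n : ℝ) ^ 4 / 2 * ((((box (3 + 1) n).card : ℝ))⁻¹ * (2 * ((((3 : ℕ) : ℝ)) + 1) ^ 2 * (n : ℝ) ^ (3 + 1))))) * Real.exp ((kappa163 4 / 4 / (4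 * ((n : ℕ) : ℝ))) * (l1 (ctr 4 n) + ((3 + 1 : ℕ) : ℝ) * (n : ℝ))))
        * Real.exp (-(kappa163 4 / 4 / (4 * ((n : ℕ) : ℝ))) * l1 (x - (n : ℤ) • y)) := by
  have hn1 : 1 ≤ n := le_trans (by norm_num) hn3
  have hn0 : 0 < n := hn1
  have hξ : (0 : ℝ) ≤ (n : ℝ) ^ 4 / 2 := by positivity
  rw [abs_neg]
  have h := abs_blockSymbol_le_mass_split (d := 3) hn0 (pin_interior_weight_nonneg n) (pin_face_weight_nonneg n) (pin_rate_nonneg n)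
    (μ := μ) (y := y) (fun x => ∃ i, off n x i = 0 ∨ off n x i = n - 1) (abs_colH_G₀_pin_interior_le n μ y)
    (abs_colH_G₀_pin_face_le n μ y _) (ctr 4 n) (c := fun α x' => (n : ℝ) ^ 4 / 2 * faceWt (ctrOff 4 n) n α x')
    (fun Y => interiorMass_smul_faceWt_le (d := 3) hn1 _ ((n : ℝ) ^ 4 / 2) Y) (faceMass_smul_faceWt_le (d := 3) hn3 ((n : ℝ) ^ 4 / 2)) x b
  rw [abs_of_nonneg hξ] at h
  exact h

/-- [folklore] The face Λ-generator's envelope constant `GΛ(n)` is non-negative. -/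
theorem faceLamGenConst_nonneg (hn3 : 3 ≤ n) :
    0 ≤ ((((((n : ℕ) : ℝ) ^ 5)⁻¹ * (8 * (MD163 4 * periodConst (kappa163 4) 3) * Real.exp (kappa163 4 / 4))) * ((n : ℝ) ^ 4 / 2 * ((((3 : ℕ) : ℝ) + 1) * ((n : ℝ) * (((3 : ℕ) : ℝ) + 1)))) + ((((n : ℕ) : ℝ) ^ 4)⁻¹ * ((MG163 4 * periodConst (kappa163 4) 3) * (1 + 8 * (1 + Real.exp (kappa163 4 / 4))) * Real.exp (kappa163 4 / 4))) * ((n : ℝ) ^ 4 / 2 * ((((box (3 + 1) n).card : ℝ))⁻¹ * (2 * ((((3 : ℕ) : ℝ)) + 1) ^ 2 * (n : ℝ) ^ (3 + 1))))) * Real.exp ((kappa163 4 / 4 / (4 * ((n : ℕ) : ℝ))) * (l1 (ctr 4 n) + ((3 + 1 : ℕ) : ℝ) * (n : ℝ)))) := by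
  have h := (abs_nonneg _).trans (abs_faceLamGen_G₀_legSite_le n hn3 0 0 0 (Sum.inl 0))
  exact (mul_nonneg_iff_of_pos_right (Real.exp_pos _)).1 h

/-- [folklore] **THE SAME SYMBOL THROUGH ONE ENVELOPE** (`1 ≤ n`; no split — the face-sheet power `(n⁴)⁻¹` against the whole block mass, located `≍ n`): TT25
`SymCorrectorFaceWeight.abs_blockSymbol_le_mass_of_col` with `hcol :=` g63 `abs_colH_G₀_pin_le` and `hc :=` TT25 `blockMass_smul_faceWt_eq` + TT30 `faceWtSum_ctrOff_le`
(`|ξ|·faceWtSum ≤ (n⁴∕2)·(4·(n·4))`).  This is the envelope for the blockings the split does not cover (`n = 1`); the scale-uniform count uses §1 for `n ≥ 3`. -/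
theorem abs_faceLamGen_G₀_legSite_le_one (hn : 1 ≤ n) (μ : Fin (3 + 1)) (y x : Site 4) (b : Fib 3) :
    |-(∑ α : Fin (3 + 1), ∑ x' ∈ blockSitesF n (blk n (legSite (ctr 4 n) x b)), colH (coDressKBmAt (ctr 4 n) n (KInvStep (d := 3) n 0)) n μ y α x' * (((n : ℝ) ^ 4 / 2) * faceWt (ctrOff 4 n) n α x'))|
      ≤ ((((((n : ℕ) : ℝ) ^ 4)⁻¹ * ((MG163 4 * periodConst (kappa163 4) 3) * (1 + 8 * (1 + Real.exp (kappa163 4 / 4))) * Real.exp (kappa163 4 / 4))) * ((n : ℝ) ^ 4 / 2 * ((((3 : ℕ) : ℝ) + 1) * ((n : ℝ) * (((3 : ℕ) : ℝ) + 1))))) * Real.exp ((kappa163 4 / 4 / (4 * ((n : ℕ) : ℝ))) * (l1 (ctr 4 n) + ((3 + 1 : ℕ) : ℝ) * (n : ℝ))))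
        * Real.exp (-(kappa163 4 / 4 / (4 * ((n : ℕ) : ℝ))) * l1 (x - (n : ℤ) • y)) := by
  have hn0 : 0 < n := hn
  have hξ : (0 : ℝ) ≤ (n : ℝ) ^ 4 / 2 := by positivity
  rw [abs_neg]
  have hc : ∀ Y : Site 4, ∑ α : Fin (3 + 1), ∑ x' ∈ blockSitesF n Y, |(n : ℝ) ^ 4 / 2 * faceWt (ctrOff 4 n) n α x'|
      ≤ (n : ℝ) ^ 4 / 2 * ((((3 : ℕ) : ℝ) + 1) * ((n : ℝ) * (((3 : ℕ) : ℝ) + 1))) := by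
    intro Y
    rw [blockMass_smul_faceWt_eq hn0 (ctrOff 4 n) ((n : ℝ) ^ 4 / 2) Y, abs_of_nonneg hξ]
    exact mul_le_mul_of_nonneg_left (faceWtSum_ctrOff_le (d := 3) hn) hξ
  exact abs_blockSymbol_le_mass_of_col (d := 3) hn0 (pin_face_weight_nonneg n) (pin_rate_nonneg n) (μ := μ) (y := y)
    (fun α x' => abs_colH_G₀_pin_le n μ y α x') (ctr 4 n) (c := fun α x' => (n : ℝ) ^ 4 / 2 * faceWt (ctrOff 4 n) n α x') hc x b

/-- [folklore] The one-envelope constant is non-negative. -/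
theorem faceLamGenConstOne_nonneg (hn : 1 ≤ n) :
    0 ≤ ((((((n : ℕ) : ℝ) ^ 4)⁻¹ * ((MG163 4 * periodConst (kappa163 4) 3) * (1 + 8 * (1 + Real.exp (kappa163 4 / 4))) * Real.exp (kappa163 4 / 4))) * ((n : ℝ) ^ 4 / 2 * ((((3 : ℕ) : ℝ) + 1) * ((n : ℝ) * (((3 : ℕ) : ℝ) + 1))))) * Real.exp ((kappa163 4 / 4 / (4 * ((n : ℕ) : ℝ))) * (l1 (ctr 4 n) + ((3 + 1 : ℕ) : ℝ) * (n : ℝ)))) := by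
  have h := (abs_nonneg _).trans (abs_faceLamGen_G₀_legSite_le_one n hn 0 0 0 (Sum.inl 0))
  exact (mul_nonneg_iff_of_pos_right (Real.exp_pos _)).1 h


/-! ## §2 The (lamf) bracket word against any bounded leg and any vertex family of weighted mass -/

/-- **THE (lamf) BRACKET WORD IN MASS CURRENCY — ANY GENERATOR ENVELOPE, ANY BOUNDED LEG, ANY VERTEX FAMILY** [our objects + folklore] (envelope BINDER `hg : |Λf-symbol| ≤ GT·e^{−r_G|x − n•y|₁}`, `0 ≤ GT` — §1 gives `GT := GΛ(n)` for `n ≥ 3`, `GΛ₁(n)` for `n ≥ 1`; modulo `Bdd G S`, `0 ≤ S`; rate `0 < σ ≤ r_G = κ′∕(4n)`;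
BINDER `hV`: the σ-weighted `ℓ¹` mass about `n•y′` of the family `V ν y′` is `≤ MV` — TT27a's `hVA ∕ hVE` socket): for every scalar `c` and directions `(a, e)`,
`Decay510 (z ↦ c·tadpole G ((Λf e z∘V a 0 − V a 0∘Λf e z) + (Λf a 0∘V e z − V e z∘Λf a 0))) (|c|·(S·(2·GT·MV + 2·GT·MV))) (n·σ)` — TT27a `decay510_bracketWord_of_wmass`
(the envelope re-read at the slower rate `σ ≤ r_G`).  With `V := vertexOfK G₀ n S♭` resp. `vertexOfK G₀ n S⁰` this prices the HEAD's two half-words separately; §4 prices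
their DIFFERENCE through the Λ-sector family alone. -/
theorem decay510_row_lamf_bracket_mass_of_env {GT : ℝ} (hGT0 : 0 ≤ GT)
    (hg : ∀ (μ : Fin (3 + 1)) (y x : Site 4) (b : Fib 3),
      |-(∑ α : Fin (3 + 1), ∑ x' ∈ blockSitesF n (blk n (legSite (ctr 4 n) x b)), colH (coDressKBmAt (ctr 4 n) n (KInvStep (d := 3) n 0)) n μ y α x' * (((n : ℝ) ^ 4 / 2) * faceWt (ctrOff 4 n) n α x'))|
        ≤ GT * Real.exp (-(kappa163 4 / 4 / (4 * ((n : ℕ) : ℝ))) * l1 (x - (n : ℤ) • y)))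
    {G : MKer 4 (Fib 3)} {S : ℝ} (hG : Bdd G S) (hS : 0 ≤ S)
    {σ MV : ℝ} (hσ : 0 < σ) (hσr : σ ≤ kappa163 4 / 4 / (4 * ((n : ℕ) : ℝ)))
    {V : Fin (3 + 1) → Site 4 → MKer 4 (Fib 3)}
    (hV : ∀ (ν : Fin (3 + 1)) (y' : Site 4), (Summable fun pr : Site 4 × Site 4 =>
        (∑ a : Fib 3, ∑ b : Fib 3, |V ν y' pr.1 pr.2 a b|)
          * Real.exp (σ * (l1 (pr.1 - (n : ℤ) • y') + l1 (pr.2 - (n : ℤ) • y')))) ∧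
      ∑' pr : Site 4 × Site 4,
          (∑ a : Fib 3, ∑ b : Fib 3, |V ν y' pr.1 pr.2 a b|)
            * Real.exp (σ * (l1 (pr.1 - (n : ℤ) • y') + l1 (pr.2 - (n : ℤ) • y'))) ≤ MV)
    (c : ℝ) (a e : Fin (3 + 1)) :
    Decay510 (fun z : Site 4 => c * tadpole G
        ((comp (diagK fun x b => -(∑ α : Fin (3 + 1), ∑ x' ∈ blockSitesF n (blk n (legSite (ctr 4 n) x b)), colH (coDressKBmAt (ctr 4 n) n (KInvStep (d := 3) n 0)) n e z α x' * (((n : ℝ) ^ 4 / 2) * faceWt (ctrOff 4 n) n α x'))) (V a 0) - comp (V a 0) (diagK fun x b => -(∑ α : Fin (3 + 1), ∑ x' ∈ blockSitesF n (blk n (legSite (ctr 4 n) x b)), colH (coDressKBmAt (ctr 4 n) n (KInvStep (d := 3) n 0)) n e z α x' * (((n : ℝ) ^ 4 / 2) * faceWt (ctrOff 4 n) n α x'))))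
              + (comp (diagK fun x b => -(∑ α : Fin (3 + 1), ∑ x' ∈ blockSitesF n (blk n (legSite (ctr 4 n) x b)), colH (coDressKBmAt (ctr 4 n) n (KInvStep (d := 3) n 0)) n a 0 α x' * (((n : ℝ) ^ 4 / 2) * faceWt (ctrOff 4 n) n α x'))) (V e z) - comp (V e z) (diagK fun x b => -(∑ α : Fin (3 + 1), ∑ x' ∈ blockSitesF n (blk n (legSite (ctr 4 n) x b)), colH (coDressKBmAt (ctr 4 n) n (KInvStep (d := 3) n 0)) n a 0 α x' * (((n : ℝ) ^ 4 / 2) * faceWt (ctrOff 4 n) n α x'))))))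
      (|c| * (S * (2 * GT * MV + 2 * GT * MV))) ((n : ℝ) * σ) := by
  -- the symbol families, re-read at the common slower rate `σ ≤ r_G`
  have hg' : ∀ (μ : Fin (3 + 1)) (y x : Site 4) (b : Fib 3),
      |-(∑ α : Fin (3 + 1), ∑ x' ∈ blockSitesF n (blk n (legSite (ctr 4 n) x b)), colH (coDressKBmAt (ctr 4 n) n (KInvStep (d := 3) n 0)) n μ y α x' * (((n : ℝ) ^ 4 / 2) * faceWt (ctrOff 4 n) n α x'))|
        ≤ GT * Real.exp (-σ * l1 (x - (n : ℤ) • y)) := by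
    intro μ y x b
    refine (hg μ y x b).trans ?_
    refine mul_le_mul_of_nonneg_left (Real.exp_le_exp.2 ?_) hGT0
    have h0 : 0 ≤ l1 (x - (n : ℤ) • y) := l1_nonneg _
    nlinarith
  exact decay510_bracketWord_of_wmass (d := 3) hG hS n
    (gA := fun y x b => -(∑ α : Fin (3 + 1), ∑ x' ∈ blockSitesF n (blk n (legSite (ctr 4 n) x b)), colH (coDressKBmAt (ctr 4 n) n (KInvStep (d := 3) n 0)) n a y α x' * (((n : ℝ) ^ 4 / 2) * faceWt (ctrOff 4 n) n α x')))
    (gE := fun y x b => -(∑ α : Fin (3 + 1), ∑ x' ∈ blockSitesF n (blk n (legSite (ctr 4 n) x b)), colH (coDressKBmAt (ctr 4 n) n (KInvStep (d := 3) n 0)) n e y α x' * (((n : ℝ) ^ 4 / 2) * faceWt (ctrOff 4 n) n α x')))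
    hGT0 hσ.le (fun y x b => hg' a y x b) (fun y x b => hg' e y x b)
    (VA := fun y => V a y) (VE := fun y => V e y) (σ := σ) (MV := MV) le_rfl (fun y => hV a y) (fun y => hV e y) c

/-! ## §3 The identities: `V⁰ = V♭ + cΛ • V_Λ`; the (lamf) word is `(−cΛ) •` the Λ-sector bracket word -/

/-- [folklore] **THE LITERAL's LEVEL-0 VERTEX SPLITS OFF ITS Λ-SECTOR**: `vertexOfK G₀ n S⁰ μ y = vertexOfK G₀ n S♭ μ y + cΛ • vertexOfK G₀ n S_Λ μ y` (`S⁰ = S♭ + cΛ•S_Λ` —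
`JsB12CombSh0_S_zero`, `symTablesAn1S2_V ∕ _H`; an2 `vertexOfK_add`: `G₀` decays (`decays_coDressKBmAt_KInvStep`), both packs bounded (g62 `locStencil_Sflat_record ∕ _SLam_record`); `vertexOfK_smul` by term). -/
theorem vertexOfK_G₀_S_zero_eq (hodd : Odd n) (N : ℕ) (cΛ : ℝ) (μ : Fin (3 + 1)) (y : Site 4) :
    (vertexOfK (coDressKBmAt (ctr 4 n) n (KInvStep (d := 3) n 0)) n (JsB12CombSh0 hodd N (symTablesAn1S2 3 n cΛ) cΛ (-((n : ℝ) ^ 12 / 4)) 0).S μ y)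
      = (vertexOfK (coDressKBmAt (ctr 4 n) n (KInvStep (d := 3) n 0)) n (fun κ u => ((n : ℝ) ^ 4) • wilsonA 3 κ u + (-((n : ℝ) ^ 8 / 2)) • symVhSAt (ctr 4 n) 3 n rfl κ u) μ y)
        + cΛ • (vertexOfK (coDressKBmAt (ctr 4 n) n (KInvStep (d := 3) n 0)) n (SLam n (lamCoeffOf (KInv (N := n)) n) (symHessFFAt (ctr 4 n) n)) μ y) := by
  have hn1 : 1 ≤ n := Nat.one_le_iff_ne_zero.2 (NeZero.ne n)
  have hK : ∃ δ C : ℝ, 0 < δ ∧ 0 ≤ C ∧ Decays (coDressKBmAt (ctr 4 n) n (KInvStep (d := 3) n 0)) C δ :=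
    decays_coDressKBmAt_KInvStep (d := 3) (Lc := n) (ctrOff_mem_box hn1) 0
  -- sup bounds of the two packs
  have hr : 0 < kappa163 4 / 4 / (4 * ((n : ℕ) : ℝ)) := by
    have := kappa163_pos 4
    have : (0 : ℝ) < n := by exact_mod_cast hn1
    positivity
  obtain ⟨Cfl, hfl⟩ : ∃ Cfl : ℝ, LocStencil (fun κ u => ((n : ℝ) ^ 4) • wilsonA 3 κ u + (-((n : ℝ) ^ 8 / 2)) • symVhSAt (ctr 4 n) 3 n rfl κ u) Cfl 0 := ⟨_, locStencil_Sflat_record n le_rfl⟩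
  obtain ⟨CΛ, hΛ'⟩ : ∃ CΛ : ℝ, LocStencil (SLam n (lamCoeffOf (KInv (N := n)) n) (symHessFFAt (ctr 4 n) n)) CΛ (kappa163 4 / 4 / (4 * ((n : ℕ) : ℝ)) / 2) :=
    ⟨_, locStencil_SLam_record n hr le_rfl⟩
  have hCfl0 : 0 ≤ Cfl := (hfl 0 0).nonneg (Sum.inl 0)
  have hCΛ0 : 0 ≤ CΛ := (hΛ' 0 0).nonneg (Sum.inl 0)
  have hS : ∀ (κ' : Fin (3 + 1)) (u x z : Site 4) (a b : Fib 3),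
      |(fun κ u => ((n : ℝ) ^ 4) • wilsonA 3 κ u + (-((n : ℝ) ^ 8 / 2)) • symVhSAt (ctr 4 n) 3 n rfl κ u) κ' u x z a b| ≤ Cfl + |cΛ| * CΛ := by
    intro κ' u x z a b
    have h := hfl κ' u x z a b
    rw [neg_zero, zero_mul, Real.exp_zero, mul_one] at h
    have : 0 ≤ |cΛ| * CΛ := mul_nonneg (abs_nonneg _) hCΛ0
    linarith
  have hT : ∀ (κ' : Fin (3 + 1)) (u x z : Site 4) (a b : Fib 3),
      |(fun κ u => cΛ • (SLam n (lamCoeffOf (KInv (N := n)) n) (symHessFFAt (ctr 4 n) n)) κ u) κ' u x z a b| ≤ Cfl + |cΛ| * CΛ := by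
    intro κ' u x z a b
    have h := hΛ' κ' u x z a b
    have hexp : Real.exp (-(kappa163 4 / 4 / (4 * ((n : ℕ) : ℝ)) / 2) * (l1 (x - u) + l1 (z - u))) ≤ 1 := by
      rw [Real.exp_le_one_iff]
      have h1 : 0 ≤ l1 (x - u) := l1_nonneg _
      have h2 : 0 ≤ l1 (z - u) := l1_nonneg _
      nlinarith
    have hb : |(SLam n (lamCoeffOf (KInv (N := n)) n) (symHessFFAt (ctr 4 n) n)) κ' u x z a b| ≤ CΛ := h.trans (by nlinarith)
    simp only [Pi.smul_apply, smul_eq_mul, abs_mul]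
    have : |cΛ| * |(SLam n (lamCoeffOf (KInv (N := n)) n) (symHessFFAt (ctr 4 n) n)) κ' u x z a b| ≤ |cΛ| * CΛ := mul_le_mul_of_nonneg_left hb (abs_nonneg _)
    linarith
  have h := vertexOfK_add (N := n) hK (S := (fun κ u => ((n : ℝ) ^ 4) • wilsonA 3 κ u + (-((n : ℝ) ^ 8 / 2)) • symVhSAt (ctr 4 n) 3 n rfl κ u))
    (T := fun κ u => cΛ • (SLam n (lamCoeffOf (KInv (N := n)) n) (symHessFFAt (ctr 4 n) n)) κ u) hS hT μ y
  -- the scalar factors out of the Λ-part (lit `DecLiftAdjoint.vertexOfK_smul`, re-proved by term: `tsum_mul_left`)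
  have hsm : vertexOfK (coDressKBmAt (ctr 4 n) n (KInvStep (d := 3) n 0)) n (fun κ u => cΛ • (SLam n (lamCoeffOf (KInv (N := n)) n) (symHessFFAt (ctr 4 n) n)) κ u) μ y
      = cΛ • (vertexOfK (coDressKBmAt (ctr 4 n) n (KInvStep (d := 3) n 0)) n (SLam n (lamCoeffOf (KInv (N := n)) n) (symHessFFAt (ctr 4 n) n)) μ y) := by
    funext x w a b
    simp only [vertexOfK, OneStepResolventKernel.wsum, Pi.smul_apply, smul_eq_mul]
    rw [Finset.mul_sum]
    refine Finset.sum_congr rfl (fun κ' _ => ?_)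
    rw [← tsum_mul_left]
    exact tsum_congr fun u => by ring
  rw [hsm] at h
  rw [JsB12CombSh0_S_zero]
  simp only [SymSecondOrderTablesAn1.symTablesAn1S2_V, SymSecondOrderTablesAn1.symTablesAn1S2_H]
  exact h

/-- [folklore] **THE (lamf) WORD IS `(−cΛ) •` THE Λ-SECTOR BRACKET WORD**: at every coarse `z` and directions `(a, e)`,
`([Λf e z, V♭ a 0] + [Λf a 0, V♭ e z]) − ([Λf e z, V⁰ a 0] + [Λf a 0, V⁰ e z]) = (−cΛ) • ([Λf e z, V_Λ a 0] + [Λf a 0, V_Λ e z])` — `vertexOfK_G₀_S_zero_eq` and the entries of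
a diagonal bracket (`comp_diagK_left ∕ comp_diagK_right`: `[diagK g, V] x w f g′ = V x w f g′·(g x f − g w g′)`), `ring`. -/
theorem lamfWord_eq (hodd : Odd n) (N : ℕ) (cΛ : ℝ) (a e : Fin (3 + 1)) (z : Site 4) :
    (((comp (diagK fun x b => -(∑ α : Fin (3 + 1), ∑ x' ∈ blockSitesF n (blk n (legSite (ctr 4 n) x b)), colH (coDressKBmAt (ctr 4 n) n (KInvStep (d := 3) n 0)) n e z α x' * (((n : ℝ) ^ 4 / 2) * faceWt (ctrOff 4 n) n α x'))) (vertexOfK (coDressKBmAt (ctr 4 n) n (KInvStep (d := 3) n 0)) n (fun κ u => ((n : ℝ) ^ 4) • wilsonA 3 κ u + (-((n : ℝ) ^ 8 / 2)) • symVhSAt (ctr 4 n) 3 n rfl κ u) a 0) - comp (vertexOfK (coDressKBmAt (ctr 4 n) n (KInvStep (d := 3) n 0)) n (fun κ u => ((n : ℝ) ^ 4) • wilsonA 3 κ u + (-((n : ℝ) ^ 8 / 2)) • symVhSAt (ctr 4 n) 3 n rfl κ u) a 0) (diagK fun x b => -(∑ α : Fin (3 + 1), ∑ x' ∈ blockSitesF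 n (blk n (legSite (ctr 4 n) x b)), colH (coDressKBmAt (ctr 4 n) n (KInvStep (d := 3) n 0)) n e z α x' * (((n : ℝ) ^ 4 / 2) * faceWt (ctrOff 4 n) n α x'))))
              + (comp (diagK fun x b => -(∑ α : Fin (3 + 1), ∑ x' ∈ blockSitesF n (blk n (legSite (ctr 4 n) x b)), colH (coDressKBmAt (ctr 4 n) n (KInvStep (d := 3) n 0)) n a 0 α x' * (((n : ℝ) ^ 4 / 2) * faceWt (ctrOff 4 n) n α x'))) (vertexOfK (coDressKBmAt (ctr 4 n) n (KInvStep (d := 3) n 0)) n (fun κ u => ((n : ℝ) ^ 4) • wilsonA 3 κ u + (-((n : ℝ) ^ 8 / 2)) • symVhSAt (ctr 4 n) 3 n rfl κ u) e z) - comp (vertexOfK (coDressKBmAt (ctr 4 n) n (KInvStep (d := 3) n 0)) n (fun κ u => ((n : ℝ) ^ 4) • wilsonA 3 κ u + (-((n : ℝ) ^ 8 / 2)) • symVhSAt (ctr 4 n) 3 n rfl κ u) e z) (diagK fun x b => -(∑ α : Fin (3 + 1), ∑ x' ∈ blockSitesF n (blk n (legSite (ctr 4 n) x b)), colH (coDressKBmAt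 (ctr 4 n) n (KInvStep (d := 3) n 0)) n a 0 α x' * (((n : ℝ) ^ 4 / 2) * faceWt (ctrOff 4 n) n α x')))))
            - ((comp (diagK fun x b => -(∑ α : Fin (3 + 1), ∑ x' ∈ blockSitesF n (blk n (legSite (ctr 4 n) x b)), colH (coDressKBmAt (ctr 4 n) n (KInvStep (d := 3) n 0)) n e z α x' * (((n : ℝ) ^ 4 / 2) * faceWt (ctrOff 4 n) n α x'))) (vertexOfK (coDressKBmAt (ctr 4 n) n (KInvStep (d := 3) n 0)) n (JsB12CombSh0 hodd N (symTablesAn1S2 3 n cΛ) cΛ (-((n : ℝ) ^ 12 / 4)) 0).S a 0) - comp (vertexOfK (coDressKBmAt (ctr 4 n) n (KInvStep (d := 3) n 0)) n (JsB12CombSh0 hodd N (symTablesAn1S2 3 n cΛ) cΛ (-((n : ℝ) ^ 12 / 4)) 0).S a 0) (diagK fun x b => -(∑ α : Fin (3 + 1), ∑ x' ∈ blockSitesF n (blk n (legSite (ctr 4 n) x b)), colH (coDressKBmAt (ctr 4 n) n (KInvStep (d := 3) n 0)) n e z α x' * (((n : ℝ) ^ 4 / 2) * faceWt (ctrOff 4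 n) n α x'))))
              + (comp (diagK fun x b => -(∑ α : Fin (3 + 1), ∑ x' ∈ blockSitesF n (blk n (legSite (ctr 4 n) x b)), colH (coDressKBmAt (ctr 4 n) n (KInvStep (d := 3) n 0)) n a 0 α x' * (((n : ℝ) ^ 4 / 2) * faceWt (ctrOff 4 n) n α x'))) (vertexOfK (coDressKBmAt (ctr 4 n) n (KInvStep (d := 3) n 0)) n (JsB12CombSh0 hodd N (symTablesAn1S2 3 n cΛ) cΛ (-((n : ℝ) ^ 12 / 4)) 0).S e z) - comp (vertexOfK (coDressKBmAt (ctr 4 n) n (KInvStep (d := 3) n 0)) n (JsB12CombSh0 hodd N (symTablesAn1S2 3 n cΛ) cΛ (-((n : ℝ) ^ 12 / 4)) 0).S e z) (diagK fun x b => -(∑ α : Fin (3 + 1), ∑ x' ∈ blockSitesF n (blk n (legSite (ctr 4 n) x b)), colH (coDressKBmAt (ctr 4 n) n (KInvStep (d := 3) n 0)) n a 0 α x' * (((n : ℝ) ^ 4 / 2) * faceWt (ctrOff 4 n) n α x'))))))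
      = (-cΛ) • ((comp (diagK fun x b => -(∑ α : Fin (3 + 1), ∑ x' ∈ blockSitesF n (blk n (legSite (ctr 4 n) x b)), colH (coDressKBmAt (ctr 4 n) n (KInvStep (d := 3) n 0)) n e z α x' * (((n : ℝ) ^ 4 / 2) * faceWt (ctrOff 4 n) n α x'))) (vertexOfK (coDressKBmAt (ctr 4 n) n (KInvStep (d := 3) n 0)) n (SLam n (lamCoeffOf (KInv (N := n)) n) (symHessFFAt (ctr 4 n) n)) a 0) - comp (vertexOfK (coDressKBmAt (ctr 4 n) n (KInvStep (d := 3) n 0)) n (SLam n (lamCoeffOf (KInv (N := n)) n) (symHessFFAt (ctr 4 n) n)) a 0) (diagK fun x b => -(∑ α : Fin (3 + 1), ∑ x' ∈ blockSitesF n (blk n (legSite (ctr 4 n) x b)), colH (coDressKBmAt (ctr 4 n) n (KInvStep (d := 3) n 0)) n e z α x' * (((n : ℝ) ^ 4 / 2) * faceWt (ctrOff 4 n) n α x'))))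
              + (comp (diagK fun x b => -(∑ α : Fin (3 + 1), ∑ x' ∈ blockSitesF n (blk n (legSite (ctr 4 n) x b)), colH (coDressKBmAt (ctr 4 n) n (KInvStep (d := 3) n 0)) n a 0 α x' * (((n : ℝ) ^ 4 / 2) * faceWt (ctrOff 4 n) n α x'))) (vertexOfK (coDressKBmAt (ctr 4 n) n (KInvStep (d := 3) n 0)) n (SLam n (lamCoeffOf (KInv (N := n)) n) (symHessFFAt (ctr 4 n) n)) e z) - comp (vertexOfK (coDressKBmAt (ctr 4 n) n (KInvStep (d := 3) n 0)) n (SLam n (lamCoeffOf (KInv (N := n)) n) (symHessFFAt (ctr 4 n) n)) e z) (diagK fun x b => -(∑ α : Fin (3 + 1), ∑ x' ∈ blockSitesF n (blk n (legSite (ctr 4 n) x b)), colH (coDressKBmAt (ctr 4 n) n (KInvStep (d := 3) n 0)) n a 0 α x' * (((n : ℝ) ^ 4 / 2) * faceWt (ctrOff 4 n) n α x'))))) := by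
  rw [vertexOfK_G₀_S_zero_eq n hodd N cΛ a 0, vertexOfK_G₀_S_zero_eq n hodd N cΛ e z]
  funext x w f g
  simp only [Pi.sub_apply, Pi.add_apply, Pi.smul_apply, smul_eq_mul, comp_diagK_left, comp_diagK_right]
  ring

/-- [folklore] **… SO THE HEAD's (lamf) KERNEL IS `−cΛ∕2 ·` THE Λ-SECTOR TADPOLE**: `½·tadpole G₀ (W^{Λ}_f a 0 e z) = (−(cΛ∕2))·tadpole G₀ ([Λf e z, V_Λ a 0] + [Λf a 0, V_Λ e z])`
(`lamfWord_eq` + lit `tadpole_smul`, unconditional). -/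
theorem tadpole_lamfWord_eq (hodd : Odd n) (N : ℕ) (cΛ : ℝ) (a e : Fin (3 + 1)) (z : Site 4) :
    (1 / 2 : ℝ) * tadpole (coDressKBmAt (ctr 4 n) n (KInvStep (d := 3) n 0))
        (((comp (diagK fun x b => -(∑ α : Fin (3 + 1), ∑ x' ∈ blockSitesF n (blk n (legSite (ctr 4 n) x b)), colH (coDressKBmAt (ctr 4 n) n (KInvStep (d := 3) n 0)) n e z α x' * (((n : ℝ) ^ 4 / 2) * faceWt (ctrOff 4 n) n α x'))) (vertexOfK (coDressKBmAt (ctr 4 n) n (KInvStep (d := 3) n 0)) n (fun κ u => ((n : ℝ) ^ 4) • wilsonA 3 κ u + (-((n : ℝ) ^ 8 / 2)) • symVhSAt (ctr 4 n) 3 n rfl κ u) a 0) - comp (vertexOfK (coDressKBmAt (ctr 4 n) n (KInvStep (d := 3) n 0)) n (fun κ u => ((n : ℝ) ^ 4) • wilsonA 3 κ u + (-((n : ℝ) ^ 8 / 2)) • symVhSAt (ctr 4 n) 3 n rfl κ u) a 0) (diagK fun x b => -(∑ α : Fin (3 + 1), ∑ x' ∈ blockSitesF n (blk n (legSite (ctr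 4 n) x b)), colH (coDressKBmAt (ctr 4 n) n (KInvStep (d := 3) n 0)) n e z α x' * (((n : ℝ) ^ 4 / 2) * faceWt (ctrOff 4 n) n α x'))))
              + (comp (diagK fun x b => -(∑ α : Fin (3 + 1), ∑ x' ∈ blockSitesF n (blk n (legSite (ctr 4 n) x b)), colH (coDressKBmAt (ctr 4 n) n (KInvStep (d := 3) n 0)) n a 0 α x' * (((n : ℝ) ^ 4 / 2) * faceWt (ctrOff 4 n) n α x'))) (vertexOfK (coDressKBmAt (ctr 4 n) n (KInvStep (d := 3) n 0)) n (fun κ u => ((n : ℝ) ^ 4) • wilsonA 3 κ u + (-((n : ℝ) ^ 8 / 2)) • symVhSAt (ctr 4 n) 3 n rfl κ u) e z) - comp (vertexOfK (coDressKBmAt (ctr 4 n) n (KInvStep (d := 3) n 0)) n (fun κ u => ((n : ℝ) ^ 4) • wilsonA 3 κ u + (-((n : ℝ) ^ 8 / 2)) • symVhSAt (ctr 4 n) 3 n rfl κ u) e z) (diagK fun x b => -(∑ α : Fin (3 + 1), ∑ x' ∈ blockSitesF n (blk n (legSite (ctr 4 n) x b)), colH (coDressKBmAt (ctr 4 n)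 n (KInvStep (d := 3) n 0)) n a 0 α x' * (((n : ℝ) ^ 4 / 2) * faceWt (ctrOff 4 n) n α x')))))
            - ((comp (diagK fun x b => -(∑ α : Fin (3 + 1), ∑ x' ∈ blockSitesF n (blk n (legSite (ctr 4 n) x b)), colH (coDressKBmAt (ctr 4 n) n (KInvStep (d := 3) n 0)) n e z α x' * (((n : ℝ) ^ 4 / 2) * faceWt (ctrOff 4 n) n α x'))) (vertexOfK (coDressKBmAt (ctr 4 n) n (KInvStep (d := 3) n 0)) n (JsB12CombSh0 hodd N (symTablesAn1S2 3 n cΛ) cΛ (-((n : ℝ) ^ 12 / 4)) 0).S a 0) - comp (vertexOfK (coDressKBmAt (ctr 4 n) n (KInvStep (d := 3) n 0)) n (JsB12CombSh0 hodd N (symTablesAn1S2 3 n cΛ) cΛ (-((n : ℝ) ^ 12 / 4)) 0).S a 0) (diagK fun x b => -(∑ α : Fin (3 + 1), ∑ x' ∈ blockSitesF n (blk n (legSite (ctr 4 n) x b)), colH (coDressKBmAt (ctr 4 n) n (KInvStep (d := 3) n 0)) n e z α x' * (((n : ℝ) ^ 4 / 2) * faceWt (ctrOff 4 n) n α x'))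))
              + (comp (diagK fun x b => -(∑ α : Fin (3 + 1), ∑ x' ∈ blockSitesF n (blk n (legSite (ctr 4 n) x b)), colH (coDressKBmAt (ctr 4 n) n (KInvStep (d := 3) n 0)) n a 0 α x' * (((n : ℝ) ^ 4 / 2) * faceWt (ctrOff 4 n) n α x'))) (vertexOfK (coDressKBmAt (ctr 4 n) n (KInvStep (d := 3) n 0)) n (JsB12CombSh0 hodd N (symTablesAn1S2 3 n cΛ) cΛ (-((n : ℝ) ^ 12 / 4)) 0).S e z) - comp (vertexOfK (coDressKBmAt (ctr 4 n) n (KInvStep (d := 3) n 0)) n (JsB12CombSh0 hodd N (symTablesAn1S2 3 n cΛ) cΛ (-((n : ℝ) ^ 12 / 4)) 0).S e z) (diagK fun x b => -(∑ α : Fin (3 + 1), ∑ x' ∈ blockSitesF n (blk n (legSite (ctr 4 n) x b)), colH (coDressKBmAt (ctr 4 n) n (KInvStep (d := 3) n 0)) n a 0 α x' * (((n : ℝ) ^ 4 / 2) * faceWt (ctrOff 4 n) n α x'))))))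
      = (-(cΛ / 2)) * tadpole (coDressKBmAt (ctr 4 n) n (KInvStep (d := 3) n 0))
        ((comp (diagK fun x b => -(∑ α : Fin (3 + 1), ∑ x' ∈ blockSitesF n (blk n (legSite (ctr 4 n) x b)), colH (coDressKBmAt (ctr 4 n) n (KInvStep (d := 3) n 0)) n e z α x' * (((n : ℝ) ^ 4 / 2) * faceWt (ctrOff 4 n) n α x'))) (vertexOfK (coDressKBmAt (ctr 4 n) n (KInvStep (d := 3) n 0)) n (SLam n (lamCoeffOf (KInv (N := n)) n) (symHessFFAt (ctr 4 n) n)) a 0) - comp (vertexOfK (coDressKBmAt (ctr 4 n) n (KInvStep (d := 3) n 0)) n (SLam n (lamCoeffOf (KInv (N := n)) n) (symHessFFAt (ctr 4 n) n)) a 0) (diagK fun x b => -(∑ α : Fin (3 + 1), ∑ x' ∈ blockSitesF n (blk n (legSite (ctr 4 n) x b)), colH (coDressKBmAt (ctr 4 n) n (KInvStep (d := 3) n 0)) n e z α x' * (((n : ℝ) ^ 4 / 2) * faceWt (ctrOff 4 n) n α x'))))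
              + (comp (diagK fun x b => -(∑ α : Fin (3 + 1), ∑ x' ∈ blockSitesF n (blk n (legSite (ctr 4 n) x b)), colH (coDressKBmAt (ctr 4 n) n (KInvStep (d := 3) n 0)) n a 0 α x' * (((n : ℝ) ^ 4 / 2) * faceWt (ctrOff 4 n) n α x'))) (vertexOfK (coDressKBmAt (ctr 4 n) n (KInvStep (d := 3) n 0)) n (SLam n (lamCoeffOf (KInv (N := n)) n) (symHessFFAt (ctr 4 n) n)) e z) - comp (vertexOfK (coDressKBmAt (ctr 4 n) n (KInvStep (d := 3) n 0)) n (SLam n (lamCoeffOf (KInv (N := n)) n) (symHessFFAt (ctr 4 n) n)) e z) (diagK fun x b => -(∑ α : Fin (3 + 1), ∑ x' ∈ blockSitesF n (blk n (legSite (ctr 4 n) x b)), colH (coDressKBmAt (ctr 4 n) n (KInvStep (d := 3) n 0)) n a 0 α x' * (((n : ℝ) ^ 4 / 2) * faceWt (ctrOff 4 n) n α x'))))) := by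
  rw [lamfWord_eq n hodd N cΛ a e z, tadpole_smul]
  ring

/-! ## §4 The HEAD's literal (lamf) row at its own leg `G₀` — BINDER form -/

/-- **ROW (lamf) IN MASS CURRENCY, AT THE HEAD's LITERAL, ANY ENVELOPE, ANY Λ-VERTEX-MASS LETTER** [our objects + folklore] (leg `G₀ = coDressKBmAt ρ_c n K₀` as in `ChartDefectHead`'s pin `hWlamf`;
`n` odd; modulo the DISPLAYED `Bdd G₀ S`, `0 ≤ S`, the rate `0 < σ ≤ r_G` and the vertex-mass BINDER `hV`: the σ-weighted `ℓ¹` mass about `n•y′` of the Λ-sector family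
`V_Λ ν y′ = vertexOfK G₀ n (SLam n (lamCoeffOf (KInv n) n) (symHessFFAt ρ_c n)) ν y′` is `≤ MV`): for every `(a, e)`,
`Decay510 (z ↦ ½·tadpole G₀ (W^{Λ}_f a 0 e z)) ((|cΛ|∕2)·(S·(2·GT·MV + 2·GT·MV))) (n·σ)` for ANY generator envelope `hg` (§1) — §3 `tadpole_lamfWord_eq` puts the word in §2's shape at
`V := V_Λ`, `c := −(cΛ∕2)`. -/
theorem decay510_row_lamf_mass_of_env (hodd : Odd n) {GT : ℝ} (hGT0 : 0 ≤ GT)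
    (hg : ∀ (μ : Fin (3 + 1)) (y x : Site 4) (b : Fib 3),
      |-(∑ α : Fin (3 + 1), ∑ x' ∈ blockSitesF n (blk n (legSite (ctr 4 n) x b)), colH (coDressKBmAt (ctr 4 n) n (KInvStep (d := 3) n 0)) n μ y α x' * (((n : ℝ) ^ 4 / 2) * faceWt (ctrOff 4 n) n α x'))|
        ≤ GT * Real.exp (-(kappa163 4 / 4 / (4 * ((n : ℕ) : ℝ))) * l1 (x - (n : ℤ) • y)))
    (N : ℕ) (cΛ : ℝ) {S : ℝ} (hG : Bdd (coDressKBmAt (ctr 4 n) n (KInvStep (d := 3) n 0)) S) (hS : 0 ≤ S)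
    {σ MV : ℝ} (hσ : 0 < σ) (hσr : σ ≤ kappa163 4 / 4 / (4 * ((n : ℕ) : ℝ)))
    (hV : ∀ (ν : Fin (3 + 1)) (y' : Site 4), (Summable fun pr : Site 4 × Site 4 =>
        (∑ a : Fib 3, ∑ b : Fib 3, |(vertexOfK (coDressKBmAt (ctr 4 n) n (KInvStep (d := 3) n 0)) n (SLam n (lamCoeffOf (KInv (N := n)) n) (symHessFFAt (ctr 4 n) n)) ν y') pr.1 pr.2 a b|)
          * Real.exp (σ * (l1 (pr.1 - (n : ℤ) • y') + l1 (pr.2 - (n : ℤ) • y')))) ∧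
      ∑' pr : Site 4 × Site 4,
          (∑ a : Fib 3, ∑ b : Fib 3, |(vertexOfK (coDressKBmAt (ctr 4 n) n (KInvStep (d := 3) n 0)) n (SLam n (lamCoeffOf (KInv (N := n)) n) (symHessFFAt (ctr 4 n) n)) ν y') pr.1 pr.2 a b|)
            * Real.exp (σ * (l1 (pr.1 - (n : ℤ) • y') + l1 (pr.2 - (n : ℤ) • y'))) ≤ MV)
    (a e : Fin (3 + 1)) :
    Decay510 (fun z : Site 4 => (1 / 2 : ℝ) * tadpole (coDressKBmAt (ctr 4 n) n (KInvStep (d := 3) n 0))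
        (((comp (diagK fun x b => -(∑ α : Fin (3 + 1), ∑ x' ∈ blockSitesF n (blk n (legSite (ctr 4 n) x b)), colH (coDressKBmAt (ctr 4 n) n (KInvStep (d := 3) n 0)) n e z α x' * (((n : ℝ) ^ 4 / 2) * faceWt (ctrOff 4 n) n α x'))) (vertexOfK (coDressKBmAt (ctr 4 n) n (KInvStep (d := 3) n 0)) n (fun κ u => ((n : ℝ) ^ 4) • wilsonA 3 κ u + (-((n : ℝ) ^ 8 / 2)) • symVhSAt (ctr 4 n) 3 n rfl κ u) a 0) - comp (vertexOfK (coDressKBmAt (ctr 4 n) n (KInvStep (d := 3) n 0)) n (fun κ u => ((n : ℝ) ^ 4) • wilsonA 3 κ u + (-((n : ℝ) ^ 8 / 2)) • symVhSAt (ctr 4 n) 3 n rfl κ u) a 0) (diagK fun x b => -(∑ α : Fin (3 + 1), ∑ x' ∈ blockSitesF n (blk n (legSite (ctr 4 n) x b)), colH (coDressKBmAt (ctr 4 n) n (KInvStep (d := 3) n 0)) n e z α x' * (((n : ℝ) ^ 4 / 2) * faceWt (ctrOff 4 n) n α x'))))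
              + (comp (diagK fun x b => -(∑ α : Fin (3 + 1), ∑ x' ∈ blockSitesF n (blk n (legSite (ctr 4 n) x b)), colH (coDressKBmAt (ctr 4 n) n (KInvStep (d := 3) n 0)) n a 0 α x' * (((n : ℝ) ^ 4 / 2) * faceWt (ctrOff 4 n) n α x'))) (vertexOfK (coDressKBmAt (ctr 4 n) n (KInvStep (d := 3) n 0)) n (fun κ u => ((n : ℝ) ^ 4) • wilsonA 3 κ u + (-((n : ℝ) ^ 8 / 2)) • symVhSAt (ctr 4 n) 3 n rfl κ u) e z) - comp (vertexOfK (coDressKBmAt (ctr 4 n) n (KInvStep (d := 3) n 0)) n (fun κ u => ((n : ℝ) ^ 4) • wilsonA 3 κ u + (-((n : ℝ) ^ 8 / 2)) • symVhSAt (ctr 4 n) 3 n rfl κ u) e z) (diagK fun x b => -(∑ α : Fin (3 + 1), ∑ x' ∈ blockSitesF n (blk n (legSite (ctr 4 n) x b)), colH (coDressKBmAt (ctr 4 n) n (KInvStep (d := 3) n 0)) n a 0 α x' * (((n : ℝ) ^ 4 / 2) * faceWt (ctrOff 4 n) n α x')))))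
            - ((comp (diagK fun x b => -(∑ α : Fin (3 + 1), ∑ x' ∈ blockSitesF n (blk n (legSite (ctr 4 n) x b)), colH (coDressKBmAt (ctr 4 n) n (KInvStep (d := 3) n 0)) n e z α x' * (((n : ℝ) ^ 4 / 2) * faceWt (ctrOff 4 n) n α x'))) (vertexOfK (coDressKBmAt (ctr 4 n) n (KInvStep (d := 3) n 0)) n (JsB12CombSh0 hodd N (symTablesAn1S2 3 n cΛ) cΛ (-((n : ℝ) ^ 12 / 4)) 0).S a 0) - comp (vertexOfK (coDressKBmAt (ctr 4 n) n (KInvStep (d := 3) n 0)) n (JsB12CombSh0 hodd N (symTablesAn1S2 3 n cΛ) cΛ (-((n : ℝ) ^ 12 / 4)) 0).S a 0) (diagK fun x b => -(∑ α : Fin (3 + 1), ∑ x' ∈ blockSitesF n (blk n (legSite (ctr 4 n) x b)), colH (coDressKBmAt (ctr 4 n) n (KInvStep (d := 3) n 0)) n e z α x' * (((n : ℝ) ^ 4 / 2) * faceWt (ctrOff 4 n) n α x'))))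
              + (comp (diagK fun x b => -(∑ α : Fin (3 + 1), ∑ x' ∈ blockSitesF n (blk n (legSite (ctr 4 n) x b)), colH (coDressKBmAt (ctr 4 n) n (KInvStep (d := 3) n 0)) n a 0 α x' * (((n : ℝ) ^ 4 / 2) * faceWt (ctrOff 4 n) n α x'))) (vertexOfK (coDressKBmAt (ctr 4 n) n (KInvStep (d := 3) n 0)) n (JsB12CombSh0 hodd N (symTablesAn1S2 3 n cΛ) cΛ (-((n : ℝ) ^ 12 / 4)) 0).S e z) - comp (vertexOfK (coDressKBmAt (ctr 4 n) n (KInvStep (d := 3) n 0)) n (JsB12CombSh0 hodd N (symTablesAn1S2 3 n cΛ) cΛ (-((n : ℝ) ^ 12 / 4)) 0).S e z) (diagK fun x b => -(∑ α : Fin (3 + 1), ∑ x' ∈ blockSitesF n (blk n (legSite (ctr 4 n) x b)), colH (coDressKBmAt (ctr 4 n) n (KInvStep (d := 3) n 0)) n a 0 α x' * (((n : ℝ) ^ 4 / 2) * faceWt (ctrOff 4 n) n α x')))))))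
      ((|cΛ| / 2) * (S * (2 * GT * MV + 2 * GT * MV))) ((n : ℝ) * σ) := by
  have h := decay510_row_lamf_bracket_mass_of_env n hGT0 hg hG hS hσ hσr
    (V := fun ν y' => (vertexOfK (coDressKBmAt (ctr 4 n) n (KInvStep (d := 3) n 0)) n (SLam n (lamCoeffOf (KInv (N := n)) n) (symHessFFAt (ctr 4 n) n)) ν y')) hV (-(cΛ / 2)) a e
  rw [show |(-(cΛ / 2) : ℝ)| = |cΛ| / 2 by rw [abs_neg, abs_div, abs_two]] at h
  intro z
  have hz := h z
  dsimp only at hz ⊢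
  rw [tadpole_lamfWord_eq n hodd N cΛ a e z]
  exact hz

/-- **ROW (lamf) IN MASS CURRENCY, AT THE HEAD's LITERAL, `n ≥ 3`, ANY Λ-VERTEX-MASS LETTER** — `decay510_row_lamf_mass_of_env` at §1's split envelope `GT := GΛ(n)` (the displayed
closed constant; `O(1)` along the scales). -/
theorem decay510_row_lamf_mass_of_wmass (hodd : Odd n) (hn3 : 3 ≤ n) (N : ℕ) (cΛ : ℝ) {S : ℝ} (hG : Bdd (coDressKBmAt (ctr 4 n) n (KInvStep (d := 3) n 0)) S) (hS : 0 ≤ S)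
    {σ MV : ℝ} (hσ : 0 < σ) (hσr : σ ≤ kappa163 4 / 4 / (4 * ((n : ℕ) : ℝ)))
    (hV : ∀ (ν : Fin (3 + 1)) (y' : Site 4), (Summable fun pr : Site 4 × Site 4 =>
        (∑ a : Fib 3, ∑ b : Fib 3, |(vertexOfK (coDressKBmAt (ctr 4 n) n (KInvStep (d := 3) n 0)) n (SLam n (lamCoeffOf (KInv (N := n)) n) (symHessFFAt (ctr 4 n) n)) ν y') pr.1 pr.2 a b|)
          * Real.exp (σ * (l1 (pr.1 - (n : ℤ) • y') + l1 (pr.2 - (n : ℤ) • y')))) ∧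
      ∑' pr : Site 4 × Site 4,
          (∑ a : Fib 3, ∑ b : Fib 3, |(vertexOfK (coDressKBmAt (ctr 4 n) n (KInvStep (d := 3) n 0)) n (SLam n (lamCoeffOf (KInv (N := n)) n) (symHessFFAt (ctr 4 n) n)) ν y') pr.1 pr.2 a b|)
            * Real.exp (σ * (l1 (pr.1 - (n : ℤ) • y') + l1 (pr.2 - (n : ℤ) • y'))) ≤ MV)
    (a e : Fin (3 + 1)) :
    Decay510 (fun z : Site 4 => (1 / 2 : ℝ) * tadpole (coDressKBmAt (ctr 4 n) n (KInvStep (d := 3) n 0))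
        (((comp (diagK fun x b => -(∑ α : Fin (3 + 1), ∑ x' ∈ blockSitesF n (blk n (legSite (ctr 4 n) x b)), colH (coDressKBmAt (ctr 4 n) n (KInvStep (d := 3) n 0)) n e z α x' * (((n : ℝ) ^ 4 / 2) * faceWt (ctrOff 4 n) n α x'))) (vertexOfK (coDressKBmAt (ctr 4 n) n (KInvStep (d := 3) n 0)) n (fun κ u => ((n : ℝ) ^ 4) • wilsonA 3 κ u + (-((n : ℝ) ^ 8 / 2)) • symVhSAt (ctr 4 n) 3 n rfl κ u) a 0) - comp (vertexOfK (coDressKBmAt (ctr 4 n) n (KInvStep (d := 3) n 0)) n (fun κ u => ((n : ℝ) ^ 4) • wilsonA 3 κ u + (-((n : ℝ) ^ 8 / 2)) • symVhSAt (ctr 4 n) 3 n rfl κ u) a 0) (diagK fun x b => -(∑ α : Fin (3 + 1), ∑ x' ∈ blockSitesF n (blk n (legSite (ctr 4 n) x b)), colH (coDressKBmAt (ctr 4 n) n (KInvStep (d := 3) n 0)) n e z α x' * (((n : ℝ) ^ 4 / 2) * faceWt (ctrOff 4 n) n α x'))))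
              + (comp (diagK fun x b => -(∑ α : Fin (3 + 1), ∑ x' ∈ blockSitesF n (blk n (legSite (ctr 4 n) x b)), colH (coDressKBmAt (ctr 4 n) n (KInvStep (d := 3) n 0)) n a 0 α x' * (((n : ℝ) ^ 4 / 2) * faceWt (ctrOff 4 n) n α x'))) (vertexOfK (coDressKBmAt (ctr 4 n) n (KInvStep (d := 3) n 0)) n (fun κ u => ((n : ℝ) ^ 4) • wilsonA 3 κ u + (-((n : ℝ) ^ 8 / 2)) • symVhSAt (ctr 4 n) 3 n rfl κ u) e z) - comp (vertexOfK (coDressKBmAt (ctr 4 n) n (KInvStep (d := 3) n 0)) n (fun κ u => ((n : ℝ) ^ 4) • wilsonA 3 κ u + (-((n : ℝ) ^ 8 / 2)) • symVhSAt (ctr 4 n) 3 n rfl κ u) e z) (diagK fun x b => -(∑ α : Fin (3 + 1), ∑ x' ∈ blockSitesF n (blk n (legSite (ctr 4 n) x b)), colH (coDressKBmAt (ctr 4 n) n (KInvStep (d := 3) n 0)) n a 0 α x' * (((n : ℝ) ^ 4 / 2) * faceWt (ctrOff 4 n) n α x')))))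
            - ((comp (diagK fun x b => -(∑ α : Fin (3 + 1), ∑ x' ∈ blockSitesF n (blk n (legSite (ctr 4 n) x b)), colH (coDressKBmAt (ctr 4 n) n (KInvStep (d := 3) n 0)) n e z α x' * (((n : ℝ) ^ 4 / 2) * faceWt (ctrOff 4 n) n α x'))) (vertexOfK (coDressKBmAt (ctr 4 n) n (KInvStep (d := 3) n 0)) n (JsB12CombSh0 hodd N (symTablesAn1S2 3 n cΛ) cΛ (-((n : ℝ) ^ 12 / 4)) 0).S a 0) - comp (vertexOfK (coDressKBmAt (ctr 4 n) n (KInvStep (d := 3) n 0)) n (JsB12CombSh0 hodd N (symTablesAn1S2 3 n cΛ) cΛ (-((n : ℝ) ^ 12 / 4)) 0).S a 0) (diagK fun x b => -(∑ α : Fin (3 + 1), ∑ x' ∈ blockSitesF n (blk n (legSite (ctr 4 n) x b)), colH (coDressKBmAt (ctr 4 n) n (KInvStep (d := 3) n 0)) n e z α x' * (((n : ℝ) ^ 4 / 2) * faceWt (ctrOff 4 n) n α x'))))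
              + (comp (diagK fun x b => -(∑ α : Fin (3 + 1), ∑ x' ∈ blockSitesF n (blk n (legSite (ctr 4 n) x b)), colH (coDressKBmAt (ctr 4 n) n (KInvStep (d := 3) n 0)) n a 0 α x' * (((n : ℝ) ^ 4 / 2) * faceWt (ctrOff 4 n) n α x'))) (vertexOfK (coDressKBmAt (ctr 4 n) n (KInvStep (d := 3) n 0)) n (JsB12CombSh0 hodd N (symTablesAn1S2 3 n cΛ) cΛ (-((n : ℝ) ^ 12 / 4)) 0).S e z) - comp (vertexOfK (coDressKBmAt (ctr 4 n) n (KInvStep (d := 3) n 0)) n (JsB12CombSh0 hodd N (symTablesAn1S2 3 n cΛ) cΛ (-((n : ℝ) ^ 12 / 4)) 0).S e z) (diagK fun x b => -(∑ α : Fin (3 + 1), ∑ x' ∈ blockSitesF n (blk n (legSite (ctr 4 n) x b)), colH (coDressKBmAt (ctr 4 n) n (KInvStep (d := 3) n 0)) n a 0 α x' * (((n : ℝ) ^ 4 / 2) * faceWt (ctrOff 4 n) n α x')))))))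
      ((|cΛ| / 2) * (S * (2 * ((((((n : ℕ) : ℝ) ^ 5)⁻¹ * (8 * (MD163 4 * periodConst (kappa163 4) 3) * Real.exp (kappa163 4 / 4))) * ((n : ℝ) ^ 4 / 2 * ((((3 : ℕ) : ℝ) + 1) * ((n : ℝ) * (((3 : ℕ) : ℝ) + 1)))) + ((((n : ℕ) : ℝ) ^ 4)⁻¹ * ((MG163 4 * periodConst (kappa163 4) 3) * (1 + 8 * (1 + Real.exp (kappa163 4 / 4))) * Real.exp (kappa163 4 / 4))) * ((n : ℝ) ^ 4 / 2 * ((((box (3 + 1) n).card : ℝ))⁻¹ * (2 * ((((3 : ℕ) : ℝ)) + 1) ^ 2 * (n : ℝ) ^ (3 + 1))))) * Real.exp ((kappa163 4 / 4 / (4 * ((n : ℕ) : ℝ))) * (l1 (ctr 4 n) + ((3 + 1 : ℕ) : ℝ) * (n : ℝ)))) * MV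
          + 2 * ((((((n : ℕ) : ℝ) ^ 5)⁻¹ * (8 * (MD163 4 * periodConst (kappa163 4) 3) * Real.exp (kappa163 4 / 4))) * ((n : ℝ) ^ 4 / 2 * ((((3 : ℕ) : ℝ) + 1) * ((n : ℝ) * (((3 : ℕ) : ℝ) + 1)))) + ((((n : ℕ) : ℝ) ^ 4)⁻¹ * ((MG163 4 * periodConst (kappa163 4) 3) * (1 + 8 * (1 + Real.exp (kappa163 4 / 4))) * Real.exp (kappa163 4 / 4))) * ((n : ℝ) ^ 4 / 2 * ((((box (3 + 1) n).card : ℝ))⁻¹ * (2 * ((((3 : ℕ) : ℝ)) + 1) ^ 2 * (n : ℝ) ^ (3 + 1))))) * Real.exp ((kappa163 4 / 4 / (4 * ((n : ℕ) : ℝ))) * (l1 (ctr 4 n) + ((3 + 1 : ℕ) : ℝ) * (n : ℝ)))) * MV))) ((n : ℝ) * σ) :=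
  decay510_row_lamf_mass_of_env n hodd (faceLamGenConst_nonneg n hn3) (abs_faceLamGen_G₀_legSite_le n hn3) N cΛ hG hS hσ hσr hV a e

/-- **ROW (lamf) IN THE HEAD's BINDER SHAPES, ANY Λ-VERTEX-MASS LETTER** (`ChartDefectHead.abs_secondMoment_chartDefect_le_of_rows`' `hAlamf ∕ hBlamf`, the pin `hWlamf` LITERALLY;
displayed letters as `decay510_row_lamf_mass_of_wmass`): (i) `∀ a e, AbsMoment₂ (Wlamf a e)`; (ii) `|secondMoment Wlamf μ ν| ≤ C_lamf(MV)·Σ'_x |x|₁² e^{−(n·σ)|x|₁}` — lit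
`absMoment₂_of_decay510` + `secondMoment_abs_le_of_decay510`.  The `n`-laws of `S` and `MV` are NOT claimed. -/
theorem row_lamf_mass_of_wmass (hodd : Odd n) (hn3 : 3 ≤ n) (N : ℕ) (cΛ : ℝ) {S : ℝ} (hG : Bdd (coDressKBmAt (ctr 4 n) n (KInvStep (d := 3) n 0)) S) (hS : 0 ≤ S)
    {σ MV : ℝ} (hσ : 0 < σ) (hσr : σ ≤ kappa163 4 / 4 / (4 * ((n : ℕ) : ℝ)))
    (hV : ∀ (ν : Fin (3 + 1)) (y' : Site 4), (Summable fun pr : Site 4 × Site 4 =>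
        (∑ a : Fib 3, ∑ b : Fib 3, |(vertexOfK (coDressKBmAt (ctr 4 n) n (KInvStep (d := 3) n 0)) n (SLam n (lamCoeffOf (KInv (N := n)) n) (symHessFFAt (ctr 4 n) n)) ν y') pr.1 pr.2 a b|)
          * Real.exp (σ * (l1 (pr.1 - (n : ℤ) • y') + l1 (pr.2 - (n : ℤ) • y')))) ∧
      ∑' pr : Site 4 × Site 4,
          (∑ a : Fib 3, ∑ b : Fib 3, |(vertexOfK (coDressKBmAt (ctr 4 n) n (KInvStep (d := 3) n 0)) n (SLam n (lamCoeffOf (KInv (N := n)) n) (symHessFFAt (ctr 4 n) n)) ν y') pr.1 pr.2 a b|)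
            * Real.exp (σ * (l1 (pr.1 - (n : ℤ) • y') + l1 (pr.2 - (n : ℤ) • y'))) ≤ MV)
    (μ ν : Fin (3 + 1)) :
    (∀ a e : Fin (3 + 1), AbsMoment₂ (fun z : Site 4 => (1 / 2 : ℝ) * tadpole (coDressKBmAt (ctr 4 n) n (KInvStep (d := 3) n 0))
        (((comp (diagK fun x b => -(∑ α : Fin (3 + 1), ∑ x' ∈ blockSitesF n (blk n (legSite (ctr 4 n) x b)), colH (coDressKBmAt (ctr 4 n) n (KInvStep (d := 3) n 0)) n e z α x' * (((n : ℝ) ^ 4 / 2) * faceWt (ctrOff 4 n) n α x'))) (vertexOfK (coDressKBmAt (ctr 4 n) n (KInvStep (d := 3) n 0)) n (fun κ u => ((n : ℝ) ^ 4) • wilsonA 3 κ u + (-((n : ℝ) ^ 8 / 2)) • symVhSAt (ctr 4 n) 3 n rfl κ u) a 0) - comp (vertexOfK (coDressKBmAt (ctr 4 n) n (KInvStep (d := 3) n 0)) n (fun κ u => ((n : ℝ) ^ 4) • wilsonA 3 κ u + (-((n : ℝ) ^ 8 / 2)) • symVhSAt (ctr 4 n) 3 n rfl κ u) a 0) (diagK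 fun x b => -(∑ α : Fin (3 + 1), ∑ x' ∈ blockSitesF n (blk n (legSite (ctr 4 n) x b)), colH (coDressKBmAt (ctr 4 n) n (KInvStep (d := 3) n 0)) n e z α x' * (((n : ℝ) ^ 4 / 2) * faceWt (ctrOff 4 n) n α x'))))
              + (comp (diagK fun x b => -(∑ α : Fin (3 + 1), ∑ x' ∈ blockSitesF n (blk n (legSite (ctr 4 n) x b)), colH (coDressKBmAt (ctr 4 n) n (KInvStep (d := 3) n 0)) n a 0 α x' * (((n : ℝ) ^ 4 / 2) * faceWt (ctrOff 4 n) n α x'))) (vertexOfK (coDressKBmAt (ctr 4 n) n (KInvStep (d := 3) n 0)) n (fun κ u => ((n : ℝ) ^ 4) • wilsonA 3 κ u + (-((n : ℝ) ^ 8 / 2)) • symVhSAt (ctr 4 n) 3 n rfl κ u) e z) - comp (vertexOfK (coDressKBmAt (ctr 4 n) n (KInvStep (d := 3) n 0)) n (fun κ u => ((n : ℝ) ^ 4) • wilsonA 3 κ u + (-((n : ℝ) ^ 8 / 2)) • symVhSAt (ctr 4 n) 3 n rfl κ u) e z) (diagK fun x b => -(∑ α : Fin (3 + 1), ∑ x'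 ∈ blockSitesF n (blk n (legSite (ctr 4 n) x b)), colH (coDressKBmAt (ctr 4 n) n (KInvStep (d := 3) n 0)) n a 0 α x' * (((n : ℝ) ^ 4 / 2) * faceWt (ctrOff 4 n) n α x')))))
            - ((comp (diagK fun x b => -(∑ α : Fin (3 + 1), ∑ x' ∈ blockSitesF n (blk n (legSite (ctr 4 n) x b)), colH (coDressKBmAt (ctr 4 n) n (KInvStep (d := 3) n 0)) n e z α x' * (((n : ℝ) ^ 4 / 2) * faceWt (ctrOff 4 n) n α x'))) (vertexOfK (coDressKBmAt (ctr 4 n) n (KInvStep (d := 3) n 0)) n (JsB12CombSh0 hodd N (symTablesAn1S2 3 n cΛ) cΛ (-((n : ℝ) ^ 12 / 4)) 0).S a 0) - comp (vertexOfK (coDressKBmAt (ctr 4 n) n (KInvStep (d := 3) n 0)) n (JsB12CombSh0 hodd N (symTablesAn1S2 3 n cΛ) cΛ (-((n : ℝ) ^ 12 / 4)) 0).S a 0) (diagK fun x b => -(∑ α : Fin (3 + 1), ∑ x' ∈ blockSitesF n (blk n (legSite (ctr 4 n) x b)), colH (coDressKBmAt (ctr 4 n) n (KInvStep (d := 3)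 n 0)) n e z α x' * (((n : ℝ) ^ 4 / 2) * faceWt (ctrOff 4 n) n α x'))))
              + (comp (diagK fun x b => -(∑ α : Fin (3 + 1), ∑ x' ∈ blockSitesF n (blk n (legSite (ctr 4 n) x b)), colH (coDressKBmAt (ctr 4 n) n (KInvStep (d := 3) n 0)) n a 0 α x' * (((n : ℝ) ^ 4 / 2) * faceWt (ctrOff 4 n) n α x'))) (vertexOfK (coDressKBmAt (ctr 4 n) n (KInvStep (d := 3) n 0)) n (JsB12CombSh0 hodd N (symTablesAn1S2 3 n cΛ) cΛ (-((n : ℝ) ^ 12 / 4)) 0).S e z) - comp (vertexOfK (coDressKBmAt (ctr 4 n) n (KInvStep (d := 3) n 0)) n (JsB12CombSh0 hodd N (symTablesAn1S2 3 n cΛ) cΛ (-((n : ℝ) ^ 12 / 4)) 0).S e z) (diagK fun x b => -(∑ α : Fin (3 + 1), ∑ x' ∈ blockSitesF n (blk n (legSite (ctr 4 n) x b)), colH (coDressKBmAt (ctr 4 n) n (KInvStep (d := 3) n 0)) n a 0 α x' * (((n : ℝ) ^ 4 / 2) * faceWt (ctrOff 4 n) n α x')))))))) ∧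
      |B12Beta.secondMoment (fun (a e : Fin (3 + 1)) (z : Site 4) => (1 / 2 : ℝ) * tadpole (coDressKBmAt (ctr 4 n) n (KInvStep (d := 3) n 0))
        (((comp (diagK fun x b => -(∑ α : Fin (3 + 1), ∑ x' ∈ blockSitesF n (blk n (legSite (ctr 4 n) x b)), colH (coDressKBmAt (ctr 4 n) n (KInvStep (d := 3) n 0)) n e z α x' * (((n : ℝ) ^ 4 / 2) * faceWt (ctrOff 4 n) n α x'))) (vertexOfK (coDressKBmAt (ctr 4 n) n (KInvStep (d := 3) n 0)) n (fun κ u => ((n : ℝ) ^ 4) • wilsonA 3 κ u + (-((n : ℝ) ^ 8 / 2)) • symVhSAt (ctr 4 n) 3 n rfl κ u) a 0) - comp (vertexOfK (coDressKBmAt (ctr 4 n) n (KInvStep (d := 3) n 0)) n (fun κ u => ((n : ℝ) ^ 4) • wilsonA 3 κ u + (-((n : ℝ) ^ 8 / 2)) • symVhSAt (ctr 4 n) 3 n rfl κ u) a 0) (diagK fun x b => -(∑ α : Fin (3 + 1), ∑ x' ∈ blockSitesF n (blk n (legSite (ctr 4 n) x b)), colH (coDressKBmAt (ctr 4 n) n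 (KInvStep (d := 3) n 0)) n e z α x' * (((n : ℝ) ^ 4 / 2) * faceWt (ctrOff 4 n) n α x'))))
              + (comp (diagK fun x b => -(∑ α : Fin (3 + 1), ∑ x' ∈ blockSitesF n (blk n (legSite (ctr 4 n) x b)), colH (coDressKBmAt (ctr 4 n) n (KInvStep (d := 3) n 0)) n a 0 α x' * (((n : ℝ) ^ 4 / 2) * faceWt (ctrOff 4 n) n α x'))) (vertexOfK (coDressKBmAt (ctr 4 n) n (KInvStep (d := 3) n 0)) n (fun κ u => ((n : ℝ) ^ 4) • wilsonA 3 κ u + (-((n : ℝ) ^ 8 / 2)) • symVhSAt (ctr 4 n) 3 n rfl κ u) e z) - comp (vertexOfK (coDressKBmAt (ctr 4 n) n (KInvStep (d := 3) n 0)) n (fun κ u => ((n : ℝ) ^ 4) • wilsonA 3 κ u + (-((n : ℝ) ^ 8 / 2)) • symVhSAt (ctr 4 n) 3 n rfl κ u) e z) (diagK fun x b => -(∑ α : Fin (3 + 1), ∑ x' ∈ blockSitesF n (blk n (legSite (ctr 4 n) x b)), colH (coDressKBmAt (ctr 4 n) n (KInvStep (d := 3) n 0)) n a 0 α x' * (((n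 : ℝ) ^ 4 / 2) * faceWt (ctrOff 4 n) n α x')))))
            - ((comp (diagK fun x b => -(∑ α : Fin (3 + 1), ∑ x' ∈ blockSitesF n (blk n (legSite (ctr 4 n) x b)), colH (coDressKBmAt (ctr 4 n) n (KInvStep (d := 3) n 0)) n e z α x' * (((n : ℝ) ^ 4 / 2) * faceWt (ctrOff 4 n) n α x'))) (vertexOfK (coDressKBmAt (ctr 4 n) n (KInvStep (d := 3) n 0)) n (JsB12CombSh0 hodd N (symTablesAn1S2 3 n cΛ) cΛ (-((n : ℝ) ^ 12 / 4)) 0).S a 0) - comp (vertexOfK (coDressKBmAt (ctr 4 n) n (KInvStep (d := 3) n 0)) n (JsB12CombSh0 hodd N (symTablesAn1S2 3 n cΛ) cΛ (-((n : ℝ) ^ 12 / 4)) 0).S a 0) (diagK fun x b => -(∑ α : Fin (3 + 1), ∑ x' ∈ blockSitesF n (blk n (legSite (ctr 4 n) x b)), colH (coDressKBmAt (ctr 4 n) n (KInvStep (d := 3) n 0)) n e z α x' * (((n : ℝ) ^ 4 / 2) * faceWt (ctrOff 4 n) n α x'))))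
              + (comp (diagK fun x b => -(∑ α : Fin (3 + 1), ∑ x' ∈ blockSitesF n (blk n (legSite (ctr 4 n) x b)), colH (coDressKBmAt (ctr 4 n) n (KInvStep (d := 3) n 0)) n a 0 α x' * (((n : ℝ) ^ 4 / 2) * faceWt (ctrOff 4 n) n α x'))) (vertexOfK (coDressKBmAt (ctr 4 n) n (KInvStep (d := 3) n 0)) n (JsB12CombSh0 hodd N (symTablesAn1S2 3 n cΛ) cΛ (-((n : ℝ) ^ 12 / 4)) 0).S e z) - comp (vertexOfK (coDressKBmAt (ctr 4 n) n (KInvStep (d := 3) n 0)) n (JsB12CombSh0 hodd N (symTablesAn1S2 3 n cΛ) cΛ (-((n : ℝ) ^ 12 / 4)) 0).S e z) (diagK fun x b => -(∑ α : Fin (3 + 1), ∑ x' ∈ blockSitesF n (blk n (legSite (ctr 4 n) x b)), colH (coDressKBmAt (ctr 4 n) n (KInvStep (d := 3) n 0)) n a 0 α x' * (((n : ℝ) ^ 4 / 2) * faceWt (ctrOff 4 n) n α x'))))))) μ ν|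
        ≤ ((|cΛ| / 2) * (S * (2 * ((((((n : ℕ) : ℝ) ^ 5)⁻¹ * (8 * (MD163 4 * periodConst (kappa163 4) 3) * Real.exp (kappa163 4 / 4))) * ((n : ℝ) ^ 4 / 2 * ((((3 : ℕ) : ℝ) + 1) * ((n : ℝ) * (((3 : ℕ) : ℝ) + 1)))) + ((((n : ℕ) : ℝ) ^ 4)⁻¹ * ((MG163 4 * periodConst (kappa163 4) 3) * (1 + 8 * (1 + Real.exp (kappa163 4 / 4))) * Real.exp (kappa163 4 / 4))) * ((n : ℝ) ^ 4 / 2 * ((((box (3 + 1) n).card : ℝ))⁻¹ * (2 * ((((3 : ℕ) : ℝ)) + 1) ^ 2 * (n : ℝ) ^ (3 + 1))))) * Real.exp ((kappa163 4 / 4 / (4 * ((n : ℕ) : ℝ))) * (l1 (ctr 4 n) + ((3 + 1 : ℕ) : ℝ) * (n : ℝ)))) * MV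
          + 2 * ((((((n : ℕ) : ℝ) ^ 5)⁻¹ * (8 * (MD163 4 * periodConst (kappa163 4) 3) * Real.exp (kappa163 4 / 4))) * ((n : ℝ) ^ 4 / 2 * ((((3 : ℕ) : ℝ) + 1) * ((n : ℝ) * (((3 : ℕ) : ℝ) + 1)))) + ((((n : ℕ) : ℝ) ^ 4)⁻¹ * ((MG163 4 * periodConst (kappa163 4) 3) * (1 + 8 * (1 + Real.exp (kappa163 4 / 4))) * Real.exp (kappa163 4 / 4))) * ((n : ℝ) ^ 4 / 2 * ((((box (3 + 1) n).card : ℝ))⁻¹ * (2 * ((((3 : ℕ) : ℝ)) + 1) ^ 2 * (n : ℝ) ^ (3 + 1))))) * Real.exp ((kappa163 4 / 4 / (4 * ((n : ℕ) : ℝ))) * (l1 (ctr 4 n) + ((3 + 1 : ℕ) : ℝ) * (n : ℝ)))) * MV)))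
          * ∑' x : Site 4, l1 x ^ 2 * Real.exp (-((n : ℝ) * σ) * l1 x) := by
  have hn1 : 1 ≤ n := le_trans (by norm_num) hn3
  have hrate : 0 < (n : ℝ) * σ := mul_pos (by exact_mod_cast hn1) hσ
  have hd := fun a e => decay510_row_lamf_mass_of_wmass n hodd hn3 N cΛ hG hS hσ hσr hV a e
  refine ⟨fun a e => absMoment₂_of_decay510 hrate (hd a e), ?_⟩
  exact (secondMoment_abs_le_of_decay510 (P := fun (a e : Fin (3 + 1)) (z : Site 4) => (1 / 2 : ℝ) * tadpole (coDressKBmAt (ctr 4 n) n (KInvStep (d := 3) n 0))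
        (((comp (diagK fun x b => -(∑ α : Fin (3 + 1), ∑ x' ∈ blockSitesF n (blk n (legSite (ctr 4 n) x b)), colH (coDressKBmAt (ctr 4 n) n (KInvStep (d := 3) n 0)) n e z α x' * (((n : ℝ) ^ 4 / 2) * faceWt (ctrOff 4 n) n α x'))) (vertexOfK (coDressKBmAt (ctr 4 n) n (KInvStep (d := 3) n 0)) n (fun κ u => ((n : ℝ) ^ 4) • wilsonA 3 κ u + (-((n : ℝ) ^ 8 / 2)) • symVhSAt (ctr 4 n) 3 n rfl κ u) a 0) - comp (vertexOfK (coDressKBmAt (ctr 4 n) n (KInvStep (d := 3) n 0)) n (fun κ u => ((n : ℝ) ^ 4) • wilsonA 3 κ u + (-((n : ℝ) ^ 8 / 2)) • symVhSAt (ctr 4 n) 3 n rfl κ u) a 0) (diagK fun x b => -(∑ α : Fin (3 + 1), ∑ x' ∈ blockSitesF n (blk n (legSite (ctr 4 n) x b)), colH (coDressKBmAt (ctr 4 n) n (KInvStep (d := 3) n 0)) n e z α x' * (((n : ℝ) ^ 4 / 2) * faceWt (ctrOff 4 n) n α x'))))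
              + (comp (diagK fun x b => -(∑ α : Fin (3 + 1), ∑ x' ∈ blockSitesF n (blk n (legSite (ctr 4 n) x b)), colH (coDressKBmAt (ctr 4 n) n (KInvStep (d := 3) n 0)) n a 0 α x' * (((n : ℝ) ^ 4 / 2) * faceWt (ctrOff 4 n) n α x'))) (vertexOfK (coDressKBmAt (ctr 4 n) n (KInvStep (d := 3) n 0)) n (fun κ u => ((n : ℝ) ^ 4) • wilsonA 3 κ u + (-((n : ℝ) ^ 8 / 2)) • symVhSAt (ctr 4 n) 3 n rfl κ u) e z) - comp (vertexOfK (coDressKBmAt (ctr 4 n) n (KInvStep (d := 3) n 0)) n (fun κ u => ((n : ℝ) ^ 4) • wilsonA 3 κ u + (-((n : ℝ) ^ 8 / 2)) • symVhSAt (ctr 4 n) 3 n rfl κ u) e z) (diagK fun x b => -(∑ α : Fin (3 + 1), ∑ x' ∈ blockSitesF n (blk n (legSite (ctr 4 n) x b)), colH (coDressKBmAt (ctr 4 n) n (KInvStep (d := 3) n 0)) n a 0 α x' * (((n : ℝ) ^ 4 / 2) * faceWt (ctrOff 4 n) n α x')))))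
            - ((comp (diagK fun x b => -(∑ α : Fin (3 + 1), ∑ x' ∈ blockSitesF n (blk n (legSite (ctr 4 n) x b)), colH (coDressKBmAt (ctr 4 n) n (KInvStep (d := 3) n 0)) n e z α x' * (((n : ℝ) ^ 4 / 2) * faceWt (ctrOff 4 n) n α x'))) (vertexOfK (coDressKBmAt (ctr 4 n) n (KInvStep (d := 3) n 0)) n (JsB12CombSh0 hodd N (symTablesAn1S2 3 n cΛ) cΛ (-((n : ℝ) ^ 12 / 4)) 0).S a 0) - comp (vertexOfK (coDressKBmAt (ctr 4 n) n (KInvStep (d := 3) n 0)) n (JsB12CombSh0 hodd N (symTablesAn1S2 3 n cΛ) cΛ (-((n : ℝ) ^ 12 / 4)) 0).S a 0) (diagK fun x b => -(∑ α : Fin (3 + 1), ∑ x' ∈ blockSitesF n (blk n (legSite (ctr 4 n) x b)), colH (coDressKBmAt (ctr 4 n) n (KInvStep (d := 3) n 0)) n e z α x' * (((n : ℝ) ^ 4 / 2) * faceWt (ctrOff 4 n) n α x'))))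
              + (comp (diagK fun x b => -(∑ α : Fin (3 + 1), ∑ x' ∈ blockSitesF n (blk n (legSite (ctr 4 n) x b)), colH (coDressKBmAt (ctr 4 n) n (KInvStep (d := 3) n 0)) n a 0 α x' * (((n : ℝ) ^ 4 / 2) * faceWt (ctrOff 4 n) n α x'))) (vertexOfK (coDressKBmAt (ctr 4 n) n (KInvStep (d := 3) n 0)) n (JsB12CombSh0 hodd N (symTablesAn1S2 3 n cΛ) cΛ (-((n : ℝ) ^ 12 / 4)) 0).S e z) - comp (vertexOfK (coDressKBmAt (ctr 4 n) n (KInvStep (d := 3) n 0)) n (JsB12CombSh0 hodd N (symTablesAn1S2 3 n cΛ) cΛ (-((n : ℝ) ^ 12 / 4)) 0).S e z) (diagK fun x b => -(∑ α : Fin (3 + 1), ∑ x' ∈ blockSitesF n (blk n (legSite (ctr 4 n) x b)), colH (coDressKBmAt (ctr 4 n) n (KInvStep (d := 3) n 0)) n a 0 α x' * (((n : ℝ) ^ 4 / 2) * faceWt (ctrOff 4 n) n α x'))))))) hrate (hd μ ν)).2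

end Record

end Summit.QuantumFields.BalabanUV.Beta.D1BFx.ChartDefectRowLamfMass
end
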